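import Mathlib.MeasureTheory.Constructions.HaarToSphere
import Mathlib.MeasureTheory.Integral.MeanInequalities
import Mathlib.Analysis.MeanInequalitiesPow
import Mathlib.MeasureTheory.Group.LIntegral
import Mathlib.MeasureTheory.Measure.Haar.NormedSpace
import Mathlib.MeasureTheory.Measure.Haar.Unique
import Mathlib.Analysis.InnerProductSpace.PiL2
import HarnessLib

/-!
# The product law `Ḣ¹(ℝ³) · Ḣ¹(ℝ³) ⊂ Ḣ^{1/2}(ℝ³)`, Fourier side

First file of the discharge programme for `Literature.Analysis.FluidPDE.fujita_kato_local`
(`Literature/Analysis/FluidPDE/MildSolutions.lean`; Fujita–Kato local existence in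
`Ḣ^{1/2} ∩ L²`), which follows the Fourier-side ("cheap Navier–Stokes") majorant scheme of
Lemarié-Rieusset, *The Navier–Stokes problem in the 21st century*, 2nd ed. (2023), §8.8
(PDF pp. 207–210 of the held copy): with `E = L²(|ξ| dξ) = 𝓕Ḣ^{1/2}` and
`F = L²(|ξ|² dξ) = 𝓕Ḣ¹`, the only harmonic-analysis input of that scheme is the boundedness
of `(Z, V) ↦ |ξ|^{-1/2} (Z ∗ V)` from `F × F` to `F`, i.e. (Plancherel) the product law
`‖u v‖_{Ḣ^{1/2}(ℝ³)} ≤ C ‖u‖_{Ḣ¹(ℝ³)} ‖v‖_{Ḣ¹(ℝ³)}` (Lemarié-Rieusset, Lemma 7.3, (7.14) with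
`s = δ = 1`, PDF p. 145; Bahouri–Chemin–Danchin 2011, Cor. 2.55).

This file PROVES that law in the form in which the scheme consumes it: for measurable
`A, B : E → ℝ≥0∞` on a three-dimensional Euclidean space `E`,

  `∫⁻ ‖ξ‖ (∫⁻ A(ξ - η) B(η) dη)² dξ ≤ 48 |B(0,1)| (∫⁻ ‖ξ‖² A(ξ)² dξ) (∫⁻ ‖ξ‖² B(ξ)² dξ)`

(`Literature.Analysis.FunctionSpaces.FourierProductLaw.lintegral_enorm_mul_lconv_sq_le`; everything `ℝ≥0∞`-valued, so no
integrability hypotheses are needed). The proof is the elementary frequency splitting of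
Lemarié-Rieusset's proof of Lemma 7.3 (case `s + δ - 3/2 > 0`): split the `η`-integral into
`‖η‖ ≤ ‖ξ - η‖` and `‖ξ - η‖ ≤ ‖η‖` (`halfConv`; the second half is the first with `A`, `B`
exchanged after `η ↦ ξ - η`), apply Cauchy–Schwarz with the weight `‖η‖^{∓1}`
(`halfConv_sq_le`), Tonelli and the translation `ξ = ζ + η`, and bound the inner frequency
integral by `∫_{‖η‖ ≤ ‖ζ‖} ‖ζ + η‖ ‖η‖⁻² dη ≤ 2‖ζ‖ · 6 |B(0,1)| ‖ζ‖`, using the polar-coordinate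
value `∫_{‖η‖ < r} ‖η‖⁻² dη = 3 |B(0,1)| r` in dimension three
(`lintegral_inv_enorm_sq_ball`).

## Mathlib search

Mathlib (this pin) has no homogeneous Sobolev product laws and no weighted convolution
(Young/O'Neil) inequalities (searched `Sobolev`, `product`, `convolution_le`, `young`); used:
`integral_fun_norm_addHaar`, `integrableOn_fun_norm_addHaar` (polar coordinates,
`MeasureTheory.Constructions.HaarToSphere`), `ENNReal.lintegral_mul_le_Lp_mul_Lq`
(Cauchy–Schwarz), `lintegral_lintegral_swap` (Tonelli), `lintegral_add_right_eq_self`,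
`lintegral_sub_left_eq_self` (translation / reflection invariance; the latter needs
`Measure.IsNegInvariant volume`, found through `Measure.Haar.Unique`),
`ENNReal.rpow_add_le_mul_rpow_add_rpow`. The tree (`lean search`) has the critical embedding
`Ḣ^{1/2} ⊂ L³` only as the named fact `Literature.Analysis.FunctionSpaces.eLpNorm_three_le_eHomSobolevSeminorm_half`
(`FourierSobolevNorm.lean`), which is not used here.

## References

* P. G. Lemarié-Rieusset, *The Navier–Stokes problem in the 21st century*, 2nd ed., CRC Press
  2023 (doi:10.1201/9781003042594), Lemma 7.3 and (7.14) (PDF p. 145), §8.8 (PDF pp. 207–210).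
  [Lemarierieusset2023]
* H. Bahouri, J.-Y. Chemin, R. Danchin, *Fourier Analysis and Nonlinear PDE*, Springer 2011,
  Cor. 2.55. [BahouriCheminDanchin2011]
-/

noncomputable section

open MeasureTheory Set Filter Topology Metric
open scoped ENNReal NNReal

namespace Literature.Analysis.FunctionSpaces.FourierProductLaw

variable {E : Type*} [NormedAddCommGroup E] [InnerProductSpace ℝ E] [FiniteDimensional ℝ E]
  [MeasurableSpace E] [BorelSpace E]

/-! ### The radial integral `∫_{‖x‖ < r} ‖x‖⁻² dx = 3 |B₁| r` in dimension three -/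

omit [FiniteDimensional ℝ E] [MeasurableSpace E] [BorelSpace E] in
/-- A three-dimensional space is nontrivial. [folklore] -/
theorem nontrivial_of_finrank_eq_three (hE : Module.finrank ℝ E = 3) : Nontrivial E :=
  Module.nontrivial_of_finrank_pos (R := ℝ) (by omega)

/-- In dimension three, `x ↦ ‖x‖⁻²` is integrable on every ball about the origin
(polar coordinates: `r² · r⁻² = 1`; Stein, *Singular Integrals*, Ch. V §1 (Riesz potentials
are locally integrable)). [folklore] -/
theorem integrableOn_inv_norm_sq_ball (hE : Module.finrank ℝ E = 3) (r : ℝ) :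
    IntegrableOn (fun x : E => ((‖x‖ ^ 2)⁻¹ : ℝ)) (ball 0 r) volume := by
  haveI := nontrivial_of_finrank_eq_three hE
  refine (integrableOn_fun_norm_addHaar (volume : Measure E) (f := fun y : ℝ => (y ^ 2)⁻¹)
    (r := r)).2 ?_
  rw [hE]
  have h : EqOn (fun y : ℝ => y ^ (3 - 1) • (y ^ 2)⁻¹) (fun _ => (1 : ℝ)) (Ioo 0 r) := by
    intro y hy
    have hy0 : y ≠ 0 := hy.1.ne'
    simp only [smul_eq_mul]
    field_simp
  rw [integrableOn_congr_fun h measurableSet_Ioo]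
  exact integrableOn_const (by simp)

/-- In dimension three, `∫_{‖x‖ < r} ‖x‖⁻² dx = 3 |B(0,1)| r` (`= 4πr`) for `0 ≤ r`
(polar coordinates, Mathlib `integral_fun_norm_addHaar`). [folklore] -/
theorem integral_inv_norm_sq_ball (hE : Module.finrank ℝ E = 3) {r : ℝ} (hr : 0 ≤ r) :
    ∫ x in ball (0 : E) r, ((‖x‖ ^ 2)⁻¹ : ℝ) =
      3 * (volume (ball (0 : E) 1)).toReal * r := by
  haveI := nontrivial_of_finrank_eq_three hE
  have hind : (ball (0 : E) r).indicator (fun x : E => ((‖x‖ ^ 2)⁻¹ : ℝ)) =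
      fun x : E => (Iio r).indicator (fun y : ℝ => (y ^ 2)⁻¹) ‖x‖ := by
    funext x
    by_cases hx : ‖x‖ < r
    · simp [indicator, hx]
    · simp [indicator, hx]
  rw [← integral_indicator measurableSet_ball, hind,
    integral_fun_norm_addHaar (volume : Measure E) (fun y : ℝ => (Iio r).indicator
      (fun y : ℝ => (y ^ 2)⁻¹) y), hE]
  have hinner : ∫ y in Ioi (0 : ℝ), y ^ (3 - 1) • (Iio r).indicator (fun y : ℝ => (y ^ 2)⁻¹) y
      = r := by
    have h1 : EqOn (fun y : ℝ => y ^ (3 - 1) • (Iio r).indicator (fun y : ℝ => (y ^ 2)⁻¹) y)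
        ((Iio r).indicator fun _ => (1 : ℝ)) (Ioi 0) := by
      intro y hy
      have hy0 : (y : ℝ) ≠ 0 := (mem_Ioi.1 hy).ne'
      by_cases hyr : y < r
      · simp only [smul_eq_mul, indicator, mem_Iio, hyr, if_true]
        field_simp
      · simp [indicator, hyr]
    rw [setIntegral_congr_fun measurableSet_Ioi h1, setIntegral_indicator measurableSet_Iio,
      Ioi_inter_Iio, setIntegral_const, smul_eq_mul, mul_one, measureReal_def, Real.volume_Ioo,
      ENNReal.toReal_ofReal (by linarith)]
    ring
  rw [hinner, measureReal_def]
  simp only [nsmul_eq_mul, smul_eq_mul, Nat.cast_ofNat]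
  ring

/-- Almost every point is nonzero (Lebesgue measure has no atoms). [folklore] -/
theorem ae_ne_zero (hE : Module.finrank ℝ E = 3) : ∀ᵐ x ∂(volume : Measure E), x ≠ 0 := by
  haveI := nontrivial_of_finrank_eq_three hE
  have h : ({(0 : E)} : Set E)ᶜ ∈ ae (volume : Measure E) :=
    compl_mem_ae_iff.2 (measure_singleton (0 : E))
  filter_upwards [h] with x hx
  simpa using hx

omit [InnerProductSpace ℝ E] [FiniteDimensional ℝ E] [MeasurableSpace E] [BorelSpace E] in
/-- For `x ≠ 0`, `(‖x‖ₑ²)⁻¹ = ENNReal.ofReal (‖x‖²)⁻¹`. [folklore] -/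
theorem inv_enorm_sq_eq_ofReal {x : E} (hx : x ≠ 0) :
    (‖x‖ₑ ^ 2)⁻¹ = ENNReal.ofReal ((‖x‖ ^ 2)⁻¹) := by
  rw [ENNReal.ofReal_inv_of_pos (by positivity), ENNReal.ofReal_pow (norm_nonneg _), ofReal_norm]

/-- In dimension three, `∫⁻_{‖x‖ < r} (‖x‖ₑ²)⁻¹ = 3 |B(0,1)| r` for `0 ≤ r`
(`ℝ≥0∞`-valued form of `integral_inv_norm_sq_ball`). [folklore] -/
theorem lintegral_inv_enorm_sq_ball (hE : Module.finrank ℝ E = 3) {r : ℝ} (hr : 0 ≤ r) :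
    ∫⁻ x in ball (0 : E) r, (‖x‖ₑ ^ 2)⁻¹ =
      3 * volume (ball (0 : E) 1) * ENNReal.ofReal r := by
  have h1 : ∫⁻ x in ball (0 : E) r, (‖x‖ₑ ^ 2)⁻¹ =
      ∫⁻ x in ball (0 : E) r, ENNReal.ofReal ((‖x‖ ^ 2)⁻¹) := by
    refine lintegral_congr_ae (ae_restrict_of_ae ?_)
    filter_upwards [ae_ne_zero hE] with x hx using inv_enorm_sq_eq_ofReal hx
  rw [h1, ← ofReal_integral_eq_lintegral_ofReal (integrableOn_inv_norm_sq_ball hE r)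
    (ae_of_all _ fun x => by positivity), integral_inv_norm_sq_ball hE hr,
    ENNReal.ofReal_mul (by positivity), ENNReal.ofReal_mul (by positivity),
    ENNReal.ofReal_toReal (measure_ball_lt_top).ne]
  norm_num

/-- In dimension three, `∫⁻_{‖x‖ ≤ r} (‖x‖ₑ²)⁻¹ ≤ 6 |B(0,1)| r` for `0 ≤ r`
(the closed ball of radius `r` lies in the open ball of radius `2r` when `r > 0`). [folklore] -/
theorem lintegral_inv_enorm_sq_closedBall_le (hE : Module.finrank ℝ E = 3) {r : ℝ} (hr : 0 ≤ r) :
    ∫⁻ x in closedBall (0 : E) r, (‖x‖ₑ ^ 2)⁻¹ ≤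
      6 * volume (ball (0 : E) 1) * ENNReal.ofReal r := by
  haveI := nontrivial_of_finrank_eq_three hE
  rcases hr.eq_or_lt with rfl | hr'
  · rw [closedBall_zero, setLIntegral_measure_zero _ _ (measure_singleton _)]
    exact bot_le
  calc ∫⁻ x in closedBall (0 : E) r, (‖x‖ₑ ^ 2)⁻¹
      ≤ ∫⁻ x in ball (0 : E) (2 * r), (‖x‖ₑ ^ 2)⁻¹ :=
        lintegral_mono_set (closedBall_subset_ball (by linarith))
    _ = 3 * volume (ball (0 : E) 1) * ENNReal.ofReal (2 * r) :=
        lintegral_inv_enorm_sq_ball hE (by linarith)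
    _ = 6 * volume (ball (0 : E) 1) * ENNReal.ofReal r := by
        rw [ENNReal.ofReal_mul (by norm_num), ENNReal.ofReal_ofNat]
        ring


/-! ### The inner frequency integral -/

omit [InnerProductSpace ℝ E] [FiniteDimensional ℝ E] [MeasurableSpace E] [BorelSpace E] in
/-- For `‖η‖ ≤ ‖ζ‖` one has `‖ζ + η‖ₑ ≤ 2 ‖ζ‖ₑ`. [folklore] -/
theorem enorm_add_le_two_mul {ζ η : E} (h : ‖η‖ ≤ ‖ζ‖) : ‖ζ + η‖ₑ ≤ 2 * ‖ζ‖ₑ := by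
  rw [← ofReal_norm, ← ofReal_norm, ← ENNReal.ofReal_ofNat, ← ENNReal.ofReal_mul (by norm_num)]
  exact ENNReal.ofReal_le_ofReal ((norm_add_le _ _).trans (by linarith))

/-- The inner frequency integral of the product-law estimate: in dimension three,
`∫⁻_{‖η‖ ≤ ‖ζ‖} ‖ζ + η‖ₑ (‖η‖ₑ²)⁻¹ dη ≤ 12 |B(0,1)| ‖ζ‖ₑ²` (Lemarié-Rieusset 2023, proof of
Lemma 7.3: `∫_{|η|<|ζ|} |η|^{-2δ} dη ≲ |ζ|^{3-2δ}`, `δ = 1`). [cite: Lemarierieusset2023, Lemma 7.3 (proof)] -/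
theorem lintegral_indicator_enorm_add_mul_inv_le (hE : Module.finrank ℝ E = 3) (ζ : E) :
    ∫⁻ η, {η : E | ‖η‖ ≤ ‖ζ‖}.indicator (fun η => ‖ζ + η‖ₑ * (‖η‖ₑ ^ 2)⁻¹) η ≤
      12 * volume (ball (0 : E) 1) * ‖ζ‖ₑ ^ 2 := by
  have hset : {η : E | ‖η‖ ≤ ‖ζ‖} = closedBall (0 : E) ‖ζ‖ := by
    ext η; simp
  have hmeas : MeasurableSet {η : E | ‖η‖ ≤ ‖ζ‖} := hset ▸ measurableSet_closedBall
  rw [lintegral_indicator hmeas, hset]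
  calc ∫⁻ η in closedBall (0 : E) ‖ζ‖, ‖ζ + η‖ₑ * (‖η‖ₑ ^ 2)⁻¹
      ≤ ∫⁻ η in closedBall (0 : E) ‖ζ‖, 2 * ‖ζ‖ₑ * (‖η‖ₑ ^ 2)⁻¹ := by
        refine setLIntegral_mono (by fun_prop) fun η hη => ?_
        gcongr
        exact enorm_add_le_two_mul (mem_closedBall_zero_iff.1 hη)
    _ = 2 * ‖ζ‖ₑ * ∫⁻ η in closedBall (0 : E) ‖ζ‖, (‖η‖ₑ ^ 2)⁻¹ :=
        lintegral_const_mul _ (by fun_prop)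
    _ ≤ 2 * ‖ζ‖ₑ * (6 * volume (ball (0 : E) 1) * ENNReal.ofReal ‖ζ‖) := by
        gcongr
        exact lintegral_inv_enorm_sq_closedBall_le hE (norm_nonneg _)
    _ = 12 * volume (ball (0 : E) 1) * ‖ζ‖ₑ ^ 2 := by
        rw [ofReal_norm]
        ring

/-! ### One half of the frequency convolution -/

/-- The part of the frequency convolution `∫ A(ξ - η) B(η) dη` where `‖η‖ ≤ ‖ξ - η‖`
(low frequencies on the second factor; the integral `I₁` of Lemarié-Rieusset 2023, proof of
Lemma 7.3). [cite: Lemarierieusset2023, Lemma 7.3 (proof)] -/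
def halfConv (A B : E → ℝ≥0∞) (ξ : E) : ℝ≥0∞ :=
  ∫⁻ η, {η : E | ‖η‖ ≤ ‖ξ - η‖}.indicator (fun η => A (ξ - η) * B η) η

/-- The splitting region `{(ξ, η) | ‖η‖ ≤ ‖ξ - η‖}` is measurable. [folklore] -/
theorem measurableSet_half : MeasurableSet {p : E × E | ‖p.2‖ ≤ ‖p.1 - p.2‖} :=
  measurableSet_le (by fun_prop) (by fun_prop)

omit [InnerProductSpace ℝ E] [FiniteDimensional ℝ E] in
/-- Each slice `{η | ‖η‖ ≤ ‖ξ - η‖}` of the splitting region is measurable. [folklore] -/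
theorem measurableSet_half_slice (ξ : E) : MeasurableSet {η : E | ‖η‖ ≤ ‖ξ - η‖} :=
  measurableSet_le (by fun_prop) (by fun_prop)

/-- **Cauchy–Schwarz step.** `(halfConv A B ξ)² ≤ (∫⁻ 1_{‖η‖≤‖ξ-η‖} A(ξ-η)² (‖η‖ₑ²)⁻¹ dη) ·
(∫⁻ ‖η‖ₑ² B(η)² dη)` (Lemarié-Rieusset 2023, proof of Lemma 7.3, bound for `I₁`). [cite: Lemarierieusset2023, Lemma 7.3 (proof)] -/
theorem halfConv_sq_le (hE : Module.finrank ℝ E = 3) {A B : E → ℝ≥0∞} (hA : Measurable A)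
    (hB : Measurable B) (ξ : E) :
    halfConv A B ξ ^ 2 ≤
      (∫⁻ η, {η : E | ‖η‖ ≤ ‖ξ - η‖}.indicator (fun η => A (ξ - η) ^ 2 * (‖η‖ₑ ^ 2)⁻¹) η) *
        ∫⁻ η, ‖η‖ₑ ^ 2 * B η ^ 2 := by
  set S : Set E := {η : E | ‖η‖ ≤ ‖ξ - η‖} with hS
  -- the two Cauchy–Schwarz factors
  set f : E → ℝ≥0∞ := fun η => S.indicator (fun η => A (ξ - η) * ‖η‖ₑ⁻¹) η with hf
  set g : E → ℝ≥0∞ := fun η => ‖η‖ₑ * B η with hg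
  have hfm : Measurable f := by
    refine Measurable.indicator ?_ (measurableSet_half_slice ξ)
    exact (hA.comp (measurable_const.sub measurable_id)).mul measurable_id.enorm.inv
  have hgm : Measurable g := measurable_id.enorm.mul hB
  -- off the origin the integrand factors as `f * g`
  have hfg : ∀ η : E, η ≠ 0 → S.indicator (fun η => A (ξ - η) * B η) η = f η * g η := by
    intro η hη
    have h0 : ‖η‖ₑ ≠ 0 := by simpa using hη
    have htop : ‖η‖ₑ ≠ ∞ := enorm_ne_top
    by_cases hmem : η ∈ S
    · simp only [hf, hg, indicator_of_mem hmem]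
      calc A (ξ - η) * B η = A (ξ - η) * (‖η‖ₑ⁻¹ * ‖η‖ₑ) * B η := by
            rw [ENNReal.inv_mul_cancel h0 htop, mul_one]
        _ = A (ξ - η) * ‖η‖ₑ⁻¹ * (‖η‖ₑ * B η) := by ring
    · simp [hf, hg, indicator_of_notMem hmem]
  have h1 : halfConv A B ξ = ∫⁻ η, (f * g) η := by
    refine lintegral_congr_ae ?_
    filter_upwards [ae_ne_zero hE] with η hη
    simpa using hfg η hη
  have h2 : ∫⁻ η, (f * g) η ≤ (∫⁻ η, f η ^ (2 : ℝ)) ^ (1 / (2 : ℝ)) *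
      (∫⁻ η, g η ^ (2 : ℝ)) ^ (1 / (2 : ℝ)) :=
    ENNReal.lintegral_mul_le_Lp_mul_Lq volume Real.HolderConjugate.two_two hfm.aemeasurable
      hgm.aemeasurable
  -- identify the squares
  have hf2 : ∀ η, f η ^ (2 : ℝ) = S.indicator (fun η => A (ξ - η) ^ 2 * (‖η‖ₑ ^ 2)⁻¹) η := by
    intro η
    rw [show (2 : ℝ) = ((2 : ℕ) : ℝ) by norm_num, ENNReal.rpow_natCast]
    by_cases hmem : η ∈ S
    · simp only [hf, indicator_of_mem hmem, mul_pow, ENNReal.inv_pow]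
    · simp [hf, indicator_of_notMem hmem]
  have hg2 : ∀ η, g η ^ (2 : ℝ) = ‖η‖ₑ ^ 2 * B η ^ 2 := by
    intro η
    rw [show (2 : ℝ) = ((2 : ℕ) : ℝ) by norm_num, ENNReal.rpow_natCast, hg, mul_pow]
  simp_rw [hf2, hg2] at h2
  rw [h1]
  calc (∫⁻ η, (f * g) η) ^ 2
      ≤ ((∫⁻ η, S.indicator (fun η => A (ξ - η) ^ 2 * (‖η‖ₑ ^ 2)⁻¹) η) ^ (1 / (2 : ℝ)) *
          (∫⁻ η, ‖η‖ₑ ^ 2 * B η ^ 2) ^ (1 / (2 : ℝ))) ^ 2 := by gcongr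
    _ = (∫⁻ η, S.indicator (fun η => A (ξ - η) ^ 2 * (‖η‖ₑ ^ 2)⁻¹) η) *
          ∫⁻ η, ‖η‖ₑ ^ 2 * B η ^ 2 := by
        rw [mul_pow, ← ENNReal.rpow_natCast, ← ENNReal.rpow_natCast, ← ENNReal.rpow_mul,
          ← ENNReal.rpow_mul]
        norm_num

/-- **The weighted `L²` bound for one half.** In dimension three,
`∫⁻ ‖ξ‖ₑ (halfConv A B ξ)² dξ ≤ 12 |B(0,1)| (∫⁻ ‖ζ‖ₑ² A²) (∫⁻ ‖η‖ₑ² B²)`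
(Cauchy–Schwarz, Tonelli, the translation `ξ = ζ + η` and the inner frequency integral;
Lemarié-Rieusset 2023, proof of Lemma 7.3, homogeneous case (7.14) with `s = δ = 1`). [cite: Lemarierieusset2023, Lemma 7.3 (proof)] -/
theorem lintegral_enorm_mul_halfConv_sq_le (hE : Module.finrank ℝ E = 3) {A B : E → ℝ≥0∞}
    (hA : Measurable A) (hB : Measurable B) :
    ∫⁻ ξ, ‖ξ‖ₑ * halfConv A B ξ ^ 2 ≤
      12 * volume (ball (0 : E) 1) * (∫⁻ ζ, ‖ζ‖ₑ ^ 2 * A ζ ^ 2) *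
        ∫⁻ η, ‖η‖ₑ ^ 2 * B η ^ 2 := by
  set V := volume (ball (0 : E) 1) with hV
  set IB := ∫⁻ η, ‖η‖ₑ ^ 2 * B η ^ 2 with hIB
  -- the weighted kernel `G ξ η = 1_{‖η‖ ≤ ‖ξ-η‖} ‖ξ‖ₑ A(ξ-η)² (‖η‖ₑ²)⁻¹`
  set G : E → E → ℝ≥0∞ := fun ξ η =>
    {η : E | ‖η‖ ≤ ‖ξ - η‖}.indicator (fun η => ‖ξ‖ₑ * (A (ξ - η) ^ 2 * (‖η‖ₑ ^ 2)⁻¹)) η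
    with hG
  have hGm : Measurable (Function.uncurry G) := by
    have h : Function.uncurry G = {p : E × E | ‖p.2‖ ≤ ‖p.1 - p.2‖}.indicator
        (fun p => ‖p.1‖ₑ * (A (p.1 - p.2) ^ 2 * (‖p.2‖ₑ ^ 2)⁻¹)) := by
      funext p
      rcases p with ⟨ξ, η⟩
      simp only [Function.uncurry_apply_pair, hG, indicator, mem_setOf_eq]
    rw [h]
    refine Measurable.indicator ?_ measurableSet_half
    exact measurable_fst.enorm.mul
      (((hA.comp (measurable_fst.sub measurable_snd)).pow_const 2).mul
        (measurable_snd.enorm.pow_const 2).inv)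
  -- the translated kernel `H ζ η = 1_{‖η‖ ≤ ‖ζ‖} ‖ζ+η‖ₑ (‖η‖ₑ²)⁻¹ A(ζ)²`
  set H : E → E → ℝ≥0∞ := fun ζ η =>
    {η : E | ‖η‖ ≤ ‖ζ‖}.indicator (fun η => ‖ζ + η‖ₑ * (‖η‖ₑ ^ 2)⁻¹) η * A ζ ^ 2 with hH
  have hHm : Measurable (Function.uncurry fun η ζ => H ζ η) := by
    have h : (Function.uncurry fun η ζ => H ζ η) = fun p : E × E =>
        {p : E × E | ‖p.1‖ ≤ ‖p.2‖}.indicator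
          (fun p => ‖p.2 + p.1‖ₑ * (‖p.1‖ₑ ^ 2)⁻¹) p * A p.2 ^ 2 := by
      funext p
      rcases p with ⟨η, ζ⟩
      simp only [Function.uncurry_apply_pair, hH, indicator, mem_setOf_eq]
    rw [h]
    refine Measurable.mul (Measurable.indicator ?_ (measurableSet_le (by fun_prop) (by fun_prop)))
      ((hA.comp measurable_snd).pow_const 2)
    exact (measurable_snd.add measurable_fst).enorm.mul (measurable_fst.enorm.pow_const 2).inv
  -- Step 1: pointwise Cauchy–Schwarz
  have step1 : ∀ ξ, ‖ξ‖ₑ * halfConv A B ξ ^ 2 ≤ (∫⁻ η, G ξ η) * IB := by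
    intro ξ
    calc ‖ξ‖ₑ * halfConv A B ξ ^ 2
        ≤ ‖ξ‖ₑ * ((∫⁻ η, {η : E | ‖η‖ ≤ ‖ξ - η‖}.indicator
            (fun η => A (ξ - η) ^ 2 * (‖η‖ₑ ^ 2)⁻¹) η) * IB) := by
          gcongr
          exact halfConv_sq_le hE hA hB ξ
      _ = (∫⁻ η, G ξ η) * IB := by
          have hm : Measurable fun η => {η : E | ‖η‖ ≤ ‖ξ - η‖}.indicator
              (fun η => A (ξ - η) ^ 2 * (‖η‖ₑ ^ 2)⁻¹) η := by
            refine Measurable.indicator ?_ (measurableSet_half_slice ξ)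
            exact ((hA.comp (measurable_const.sub measurable_id)).pow_const 2).mul
              (measurable_id.enorm.pow_const 2).inv
          rw [← mul_assoc, ← lintegral_const_mul ‖ξ‖ₑ hm]
          congr 1
          refine lintegral_congr fun η => ?_
          simp only [hG]
          exact (indicator_mul_right _ (fun _ => ‖ξ‖ₑ) _).symm
  -- Step 2: translation `ξ = ζ + η` in the inner variable after Tonelli
  have step3 : ∀ η, ∫⁻ ξ, G ξ η = ∫⁻ ζ, H ζ η := by
    intro η
    rw [← lintegral_add_right_eq_self (fun ξ => G ξ η) η]
    refine lintegral_congr fun ζ => ?_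
    simp only [hG, hH]
    by_cases h : ‖η‖ ≤ ‖ζ‖
    · rw [indicator_of_mem (by simpa using h), indicator_of_mem (by simpa using h),
        add_sub_cancel_right]
      ring
    · rw [indicator_of_notMem (by simpa using h), indicator_of_notMem (by simpa using h),
        zero_mul]
  -- Step 3: the inner frequency integral
  have step5 : ∀ ζ, ∫⁻ η, H ζ η ≤ 12 * V * (‖ζ‖ₑ ^ 2 * A ζ ^ 2) := by
    intro ζ
    simp only [hH]
    rw [lintegral_mul_const]
    · rw [← mul_assoc]
      gcongr
      exact lintegral_indicator_enorm_add_mul_inv_le hE ζ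
    · refine Measurable.indicator ?_ (measurableSet_le (by fun_prop) (by fun_prop))
      exact (measurable_id.const_add ζ).enorm.mul (measurable_id.enorm.pow_const 2).inv
  -- assembly
  calc ∫⁻ ξ, ‖ξ‖ₑ * halfConv A B ξ ^ 2
      ≤ ∫⁻ ξ, (∫⁻ η, G ξ η) * IB := lintegral_mono step1
    _ = (∫⁻ ξ, ∫⁻ η, G ξ η) * IB := lintegral_mul_const _ hGm.lintegral_prod_right
    _ = (∫⁻ η, ∫⁻ ξ, G ξ η) * IB := by rw [lintegral_lintegral_swap hGm.aemeasurable]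
    _ = (∫⁻ η, ∫⁻ ζ, H ζ η) * IB := by simp_rw [step3]
    _ = (∫⁻ ζ, ∫⁻ η, H ζ η) * IB := by rw [lintegral_lintegral_swap hHm.aemeasurable]
    _ ≤ (∫⁻ ζ, 12 * V * (‖ζ‖ₑ ^ 2 * A ζ ^ 2)) * IB :=
        mul_le_mul' (lintegral_mono fun ζ => step5 ζ) le_rfl
    _ = 12 * V * (∫⁻ ζ, ‖ζ‖ₑ ^ 2 * A ζ ^ 2) * IB := by
        have hm : Measurable fun ζ => ‖ζ‖ₑ ^ 2 * A ζ ^ 2 :=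
          (measurable_id.enorm.pow_const 2).mul (hA.pow_const 2)
        rw [lintegral_const_mul (12 * V) hm]

/-! ### The product law -/

/-- `(a + b)² ≤ 2 (a² + b²)` in `ℝ≥0∞` (from Mathlib's
`ENNReal.rpow_add_le_mul_rpow_add_rpow`). [folklore] -/
theorem ennreal_add_sq_le_two_mul (a b : ℝ≥0∞) : (a + b) ^ 2 ≤ 2 * (a ^ 2 + b ^ 2) := by
  have h := ENNReal.rpow_add_le_mul_rpow_add_rpow a b (p := 2) (by norm_num)
  norm_num at h
  exact_mod_cast h

/-- `halfConv A B` is measurable for measurable `A`, `B` (Tonelli). [folklore] -/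
theorem measurable_halfConv {A B : E → ℝ≥0∞} (hA : Measurable A) (hB : Measurable B) :
    Measurable (halfConv A B) := by
  have h : (Function.uncurry fun ξ η => {η : E | ‖η‖ ≤ ‖ξ - η‖}.indicator
      (fun η => A (ξ - η) * B η) η) = {p : E × E | ‖p.2‖ ≤ ‖p.1 - p.2‖}.indicator
        (fun p => A (p.1 - p.2) * B p.2) := by
    funext p
    rcases p with ⟨ξ, η⟩
    simp only [Function.uncurry_apply_pair, indicator, mem_setOf_eq]
  have hm : Measurable (Function.uncurry fun ξ η => {η : E | ‖η‖ ≤ ‖ξ - η‖}.indicator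
      (fun η => A (ξ - η) * B η) η) := by
    rw [h]
    exact Measurable.indicator ((hA.comp (measurable_fst.sub measurable_snd)).mul
      (hB.comp measurable_snd)) measurableSet_half
  exact hm.lintegral_prod_right


/-- Splitting the frequency convolution into its two halves:
`∫ A(ξ-η) B(η) dη ≤ halfConv A B ξ + halfConv B A ξ` (for every `η` either
`‖η‖ ≤ ‖ξ - η‖` or `‖ξ - η‖ ≤ ‖η‖`; the second half is `halfConv B A` after the reflection
`η ↦ ξ - η`; Lemarié-Rieusset 2023, proof of Lemma 7.3, `I ≤ 2(I₁ + I₂)`). [cite: Lemarierieusset2023, Lemma 7.3 (proof)] -/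
theorem lintegral_mul_le_halfConv_add {A B : E → ℝ≥0∞}
    (hA : Measurable A) (hB : Measurable B) (ξ : E) :
    ∫⁻ η, A (ξ - η) * B η ≤ halfConv A B ξ + halfConv B A ξ := by
  have h2 : halfConv B A ξ =
      ∫⁻ η, {η : E | ‖ξ - η‖ ≤ ‖η‖}.indicator (fun η => A (ξ - η) * B η) η := by
    unfold halfConv
    rw [← lintegral_sub_left_eq_self
      (fun γ => {γ' : E | ‖γ'‖ ≤ ‖ξ - γ'‖}.indicator (fun γ' => B (ξ - γ') * A γ') γ) ξ]
    refine lintegral_congr fun η => ?_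
    by_cases h : ‖ξ - η‖ ≤ ‖η‖
    · rw [indicator_of_mem (by simpa [sub_sub_cancel] using h), indicator_of_mem (by simpa using h),
        sub_sub_cancel, mul_comm]
    · rw [indicator_of_notMem (by simpa [sub_sub_cancel] using h),
        indicator_of_notMem (by simpa using h)]
  rw [h2, halfConv, ← lintegral_add_left]
  · refine lintegral_mono fun η => ?_
    by_cases h : ‖η‖ ≤ ‖ξ - η‖
    · rw [indicator_of_mem (by simpa using h)]
      exact le_self_add
    · rw [indicator_of_notMem (by simpa using h),
        indicator_of_mem (by simpa using (le_of_not_ge h))]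
      simp
  · refine Measurable.indicator ?_ (measurableSet_half_slice ξ)
    exact (hA.comp (measurable_const.sub measurable_id)).mul hB

/-- **Product law `Ḣ¹ · Ḣ¹ ⊂ Ḣ^{1/2}` in dimension three, Fourier side.** For measurable
`A, B : E → ℝ≥0∞` on a three-dimensional Euclidean space,
`∫⁻ ‖ξ‖ₑ (∫⁻ A(ξ-η) B(η) dη)² dξ ≤ 48 |B(0,1)| (∫⁻ ‖ξ‖ₑ² A²) (∫⁻ ‖ξ‖ₑ² B²)`.
Applied to `A = |û|`, `B = |v̂|` (so that `|𝓕(uv)| ≤ A ∗ B`) this is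
`‖u v‖_{Ḣ^{1/2}} ≤ C ‖u‖_{Ḣ¹} ‖v‖_{Ḣ¹}` (Lemarié-Rieusset, *The Navier–Stokes problem in the
21st century*, 2nd ed. 2023, Lemma 7.3, (7.14) with `s = δ = 1`, PDF p. 145;
Bahouri–Chemin–Danchin 2011, Cor. 2.55), i.e. the boundedness of
`(Z, V) ↦ |ξ|^{-1/2}(Z ∗ V)` on `F = L²(|ξ|² dξ)` used in §8.8 (PDF p. 209); proved by the
frequency-splitting argument of Lemarié-Rieusset's proof of Lemma 7.3. [cite: Lemarierieusset2023, Lemma 7.3 (7.14), s = δ = 1] -/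
theorem lintegral_enorm_mul_lconv_sq_le (hE : Module.finrank ℝ E = 3) {A B : E → ℝ≥0∞}
    (hA : Measurable A) (hB : Measurable B) :
    ∫⁻ ξ, ‖ξ‖ₑ * (∫⁻ η, A (ξ - η) * B η) ^ 2 ≤
      48 * volume (ball (0 : E) 1) * (∫⁻ ξ, ‖ξ‖ₑ ^ 2 * A ξ ^ 2) *
        ∫⁻ ξ, ‖ξ‖ₑ ^ 2 * B ξ ^ 2 := by
  set V := volume (ball (0 : E) 1) with hV
  set IA := ∫⁻ ξ, ‖ξ‖ₑ ^ 2 * A ξ ^ 2 with hIA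
  set IB := ∫⁻ ξ, ‖ξ‖ₑ ^ 2 * B ξ ^ 2 with hIB
  have hpt : ∀ ξ, ‖ξ‖ₑ * (∫⁻ η, A (ξ - η) * B η) ^ 2 ≤
      2 * (‖ξ‖ₑ * halfConv A B ξ ^ 2) + 2 * (‖ξ‖ₑ * halfConv B A ξ ^ 2) := by
    intro ξ
    calc ‖ξ‖ₑ * (∫⁻ η, A (ξ - η) * B η) ^ 2
        ≤ ‖ξ‖ₑ * (halfConv A B ξ + halfConv B A ξ) ^ 2 := by
          gcongr
          exact lintegral_mul_le_halfConv_add hA hB ξ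
      _ ≤ ‖ξ‖ₑ * (2 * (halfConv A B ξ ^ 2 + halfConv B A ξ ^ 2)) := by
          gcongr
          exact ennreal_add_sq_le_two_mul _ _
      _ = 2 * (‖ξ‖ₑ * halfConv A B ξ ^ 2) + 2 * (‖ξ‖ₑ * halfConv B A ξ ^ 2) := by ring
  have hm1 : Measurable fun ξ => ‖ξ‖ₑ * halfConv A B ξ ^ 2 :=
    measurable_id.enorm.mul ((measurable_halfConv hA hB).pow_const 2)
  have hm2 : Measurable fun ξ => ‖ξ‖ₑ * halfConv B A ξ ^ 2 :=
    measurable_id.enorm.mul ((measurable_halfConv hB hA).pow_const 2)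
  calc ∫⁻ ξ, ‖ξ‖ₑ * (∫⁻ η, A (ξ - η) * B η) ^ 2
      ≤ ∫⁻ ξ, (2 * (‖ξ‖ₑ * halfConv A B ξ ^ 2) + 2 * (‖ξ‖ₑ * halfConv B A ξ ^ 2)) :=
        lintegral_mono hpt
    _ = 2 * (∫⁻ ξ, ‖ξ‖ₑ * halfConv A B ξ ^ 2) + 2 * (∫⁻ ξ, ‖ξ‖ₑ * halfConv B A ξ ^ 2) := by
        rw [lintegral_add_left (hm1.const_mul 2), lintegral_const_mul 2 hm1,
          lintegral_const_mul 2 hm2]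
    _ ≤ 2 * (12 * V * IA * IB) + 2 * (12 * V * IB * IA) := by
        gcongr
        · exact lintegral_enorm_mul_halfConv_sq_le hE hA hB
        · exact lintegral_enorm_mul_halfConv_sq_le hE hB hA
    _ = 48 * V * IA * IB := by ring

end Literature.Analysis.FunctionSpaces.FourierProductLaw
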